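import Summits.AtomisticToContinuum.Crystallization.Theorems.FrustratedLawDichotomyExemptLocOpt

/-!
# FrustratedLawDichotomy · crux `AperiodicFrustratedLawGap` (stmt-AtomisticToContinuum-27623) — THE SCHUR-CUT SPLIT WITH EXEMPTIONS
# (`Topt♭ / Eopt♭` of lens-5's «OptimalityCut», critic row 534 O3: the tree's T′♭ / E′♭ with an allowance `−D·#{exempt sites}`)
# (decomp-a2c, prover hand 2, structural share, generation 14; generic, radius-free)

The exemption door (`…ExemptDoor`: `DeepAbsent M Ex ∧ ExemptFDG Ex ⟹` crux) is fed in UNSPLIT form by `…ExemptRemoval.SchurRangeGapX` (FRG♭ with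
allowance).  This file types the SPLIT residuals of record with the allowance and proves the positive-combination kernel, verbatim the algebra of
`FrustratedLawDichotomySchurCut.schurRangeGap_of_split` with one more counting term carried through:

* `SchurTopologicalPricingX η₀ η₁ w ω A eUp κT CT DT Ex` (Topt♭):  `eUp·N + κ_T·(N − ℓ) − C_T·g − D_T·#Ex ≤ Σ W − A·N`;
* `SchurElasticPricingX η₀ η₁ w ω A eUp κE CE DE DX Ex` (Eopt♭):  `eUp·N + κ_E·(ℓ − g) − C_E·g − D_E·(N − ℓ) − D_X·#Ex ≤ Σ W − A·N`
  (`g = goodCount η₀`, `ℓ = goodCount η₁`, `#Ex = Nat.card {i // Ex y i}`; `D_T, D_X ≥ 0`);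
* `schurRangeGapX_of_splitX` : `Topt♭(κ_T, C_T, D_T) ∧ Eopt♭(κ_E, C_E, D_E, D_X) ⟹ FRG♭_X(eUp + κ_E κ_T/S, (M + M′)/S, Ex)` with
  `S = κ_T + D_E⁺ + κ_E`, `M = κ_T|C_E| + D_E⁺|C_T| + κ_E|C_T| + κ_E κ_T`, `M′ = κ_T D_X + (D_E⁺ + κ_E) D_T`;
* `exemptFDG_of_splitX` : `SF ∧ UP(eUp) ∧ Topt♭ ∧ Eopt♭ ⟹ ExemptFDG Ex` (lens-5's `fdgOpt_of_split`);
* BY NAME: `aperiodicFrustratedLawGap_of_splitX` (generic `w ω A eUp`, any deep-absent `Ex`), and at the node of record (range `9/2`):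
  `aperiodicFrustratedLawGap_of_splitX_fourHalf` (any deep-absent `Ex`), `…_of_split_locOpt_fourHalf` (`Ex = LocOptFails e⋆ ε ϱ K`, any `ε > 0`),
  `…_of_split_exchange_fourHalf` (`Ex = ExchangeUnstable ε ϱ K`, `e⋆`-free), `…_of_split_removal_fourHalf` (`Ex = RemovalUnstable (−0.7175) t`);
* `schurTopologicalPricingX_of_orig` / `schurElasticPricingX_of_orig` : the tree's T′♭ / E′♭ are the case `D = 0` (so nothing is lost).

Assembly of record after this file (lens-5 g38 node, O3 discharged):
  `AperiodicFrustratedLawGap ⟸ MuEquilibriumDoor (closed) ∧ SF₄₅ (hand-1 g13: THEOREM) ∧ UP(−0.7175) ∧ Topt♭₄₅(κ_T, C_T, D_T; ¬LocOpt ε ϱ K) ∧ Eopt♭₄₅(κ_E, C_E, D_E, D_X; ¬LocOpt ε ϱ K)`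
for any `ε > 0`, `ϱ`, `K`, `κ_T, κ_E > 0`, `D_T, D_X ≥ 0` — the pricing of `(ε, ϱ, K)`-EQUILIBRIA only.  All `[folklore]` bookkeeping.
-/

noncomputable section

namespace Summit.AtomisticToContinuum.Crystallization.Theorems.FrustratedLawDichotomyExemptSplit

open Literature.MathematicalPhysics.StatisticalMechanics
open Summit.AtomisticToContinuum.Crystallization.Theorems.ChargedEnergyGapNegative (E3 eStar)
open Summit.AtomisticToContinuum.Crystallization.Theorems.FrustratedLawDichotomyExemptDoor
open Summit.AtomisticToContinuum.Crystallization.Theorems.FrustratedLawDichotomyExemptRemoval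
  (RemovalUnstable removalDepth deepAbsent_removalUnstable_of_up SchurRangeGapX exemptFDG_of_schurCutX)
open Summit.AtomisticToContinuum.Crystallization.Theorems.FrustratedLawDichotomyExemptLocOpt
  (LocOpt LocOptFails ExchangeUnstable locOptDepth deepAbsent_locOptFails deepAbsent_exchangeUnstable)
open Summit.AtomisticToContinuum.Crystallization.Theorems.FrustratedLawDichotomyRangeCut
  (Sep GoodAt goodCount goodCount_mono goodCount_le FDG PeriodicEnergyCeiling eStar_le_of_periodicEnergyCeiling)
open Summit.AtomisticToContinuum.Crystallization.Theorems.FrustratedLawDichotomySchurCut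
  (SchurFloor effPot SchurTopologicalPricing SchurElasticPricing w₄₅ ω₄ SF₄₅)

/-! ## §1. The split residuals with an exemption allowance -/

/-- **Topt♭ — SCHUR-CUT TOPOLOGICAL PRICING WITH EXEMPTIONS**: `eUp·N + κ_T·(N − ℓ) − C_T·g − D_T·#{i : Ex y i} ≤ Σ W − A·N` over injective
`7/10`-separated clusters (`g = goodCount η₀`, `ℓ = goodCount η₁`). -/
def SchurTopologicalPricingX (η₀ η₁ : ℝ) (w ω : ℝ → ℝ) (A eUp κT CT DT : ℝ) (Ex : SitePred) : Prop :=
  ∀ (N : ℕ) (y : Fin N → EuclideanSpace ℝ (Fin 3)), Function.Injective y → Sep y →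
    eUp * N + κT * ((N : ℝ) - goodCount η₁ y) - CT * goodCount η₀ y - DT * (Nat.card {i : Fin N // Ex N y i} : ℝ) ≤
      interactionEnergy (effPot w ω A) y - A * N

/-- **Eopt♭ — SCHUR-CUT ELASTIC PRICING WITH EXEMPTIONS**: `eUp·N + κ_E·(ℓ − g) − C_E·g − D_E·(N − ℓ) − D_X·#{i : Ex y i} ≤ Σ W − A·N`. -/
def SchurElasticPricingX (η₀ η₁ : ℝ) (w ω : ℝ → ℝ) (A eUp κE CE DE DX : ℝ) (Ex : SitePred) : Prop :=
  ∀ (N : ℕ) (y : Fin N → EuclideanSpace ℝ (Fin 3)), Function.Injective y → Sep y →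
    eUp * N + κE * ((goodCount η₁ y : ℝ) - goodCount η₀ y) - CE * goodCount η₀ y - DE * ((N : ℝ) - goodCount η₁ y)
        - DX * (Nat.card {i : Fin N // Ex N y i} : ℝ) ≤
      interactionEnergy (effPot w ω A) y - A * N

/-- The tree's T′♭ is Topt♭ with `D_T = 0` (for any `Ex`). [folklore] -/
theorem schurTopologicalPricingX_of_orig {η₀ η₁ : ℝ} {w ω : ℝ → ℝ} {A eUp κT CT : ℝ}
    (h : SchurTopologicalPricing η₀ η₁ w ω A eUp κT CT) (Ex : SitePred) :
    SchurTopologicalPricingX η₀ η₁ w ω A eUp κT CT 0 Ex := fun N y hy hsep => by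
  have h1 := h N y hy hsep
  linarith

/-- The tree's E′♭ is Eopt♭ with `D_X = 0` (for any `Ex`). [folklore] -/
theorem schurElasticPricingX_of_orig {η₀ η₁ : ℝ} {w ω : ℝ → ℝ} {A eUp κE CE DE : ℝ}
    (h : SchurElasticPricing η₀ η₁ w ω A eUp κE CE DE) (Ex : SitePred) :
    SchurElasticPricingX η₀ η₁ w ω A eUp κE CE DE 0 Ex := fun N y hy hsep => by
  have h1 := h N y hy hsep
  linarith

/-- Topt♭ is monotone in the allowance. [folklore] -/
theorem SchurTopologicalPricingX.mono {η₀ η₁ : ℝ} {w ω : ℝ → ℝ} {A eUp κT CT DT DT' : ℝ} {Ex : SitePred}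
    (h : SchurTopologicalPricingX η₀ η₁ w ω A eUp κT CT DT Ex) (hD : DT ≤ DT') :
    SchurTopologicalPricingX η₀ η₁ w ω A eUp κT CT DT' Ex := fun N y hy hsep => by
  have h1 := h N y hy hsep
  have he0 : (0 : ℝ) ≤ Nat.card {i : Fin N // Ex N y i} := Nat.cast_nonneg _
  have h2 : DT * (Nat.card {i : Fin N // Ex N y i} : ℝ) ≤ DT' * Nat.card {i : Fin N // Ex N y i} :=
    mul_le_mul_of_nonneg_right hD he0
  linarith

/-! ## §2. The positive-combination kernel with the allowance carried -/

/-- The count of good-or-exempt sites dominates both the good count and the exempt count. [folklore] -/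
theorem counts_le {η₀ : ℝ} {Ex : SitePred} {N : ℕ} (y : Fin N → EuclideanSpace ℝ (Fin 3)) :
    (goodCount η₀ y : ℝ) ≤ Nat.card {i : Fin N // GoodAt η₀ y i ∨ Ex N y i} ∧
      (Nat.card {i : Fin N // Ex N y i} : ℝ) ≤ Nat.card {i : Fin N // GoodAt η₀ y i ∨ Ex N y i} := by
  classical
  constructor
  · exact_mod_cast Nat.card_le_card_of_injective
      (fun i : {i : Fin N // GoodAt η₀ y i} => (⟨i.1, Or.inl i.2⟩ : {i : Fin N // GoodAt η₀ y i ∨ Ex N y i}))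
      fun a b hab => Subtype.ext (by simpa using congrArg Subtype.val hab)
  · exact_mod_cast Nat.card_le_card_of_injective
      (fun i : {i : Fin N // Ex N y i} => (⟨i.1, Or.inr i.2⟩ : {i : Fin N // GoodAt η₀ y i ∨ Ex N y i}))
      fun a b hab => Subtype.ext (by simpa using congrArg Subtype.val hab)
set_option maxHeartbeats 400000 in
/-- ★ **KERNEL `Topt♭ ∧ Eopt♭ ⟹ FRG♭_X`** (positive combination at the level `eUp`; `schurRangeGap_of_split` with the allowance carried):
`Topt♭(κ_T, C_T, D_T) ∧ Eopt♭(κ_E, C_E, D_E, D_X) ⟹ FRG♭_X(eUp + κ_E κ_T/S, (M + M′)/S)`, `S = κ_T + D_E⁺ + κ_E`,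
`M = κ_T|C_E| + D_E⁺|C_T| + κ_E|C_T| + κ_E κ_T`, `M′ = κ_T D_X + (D_E⁺ + κ_E) D_T`. [folklore] -/
theorem schurRangeGapX_of_splitX {η₁ : ℝ} {w ω : ℝ → ℝ} {A eUp κT CT DT κE CE DE DX : ℝ} {Ex : SitePred}
    (h01 : (1 : ℝ) / 20 ≤ η₁)
    (hκT : 0 < κT) (hDT : 0 ≤ DT) (hT : SchurTopologicalPricingX (1 / 20) η₁ w ω A eUp κT CT DT Ex)
    (hκE : 0 < κE) (hDX : 0 ≤ DX) (hE : SchurElasticPricingX (1 / 20) η₁ w ω A eUp κE CE DE DX Ex) :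
    SchurRangeGapX w ω A (eUp + κE * κT / (κT + max DE 0 + κE))
      ((κT * |CE| + max DE 0 * |CT| + κE * |CT| + κE * κT + (κT * DX + (max DE 0 + κE) * DT)) / (κT + max DE 0 + κE)) Ex := by
  intro N y hy hsep
  set D := max DE 0 with hDdef
  have hD0 : 0 ≤ D := le_max_right _ _
  have hDE : DE ≤ D := le_max_left _ _
  set S := κT + D + κE with hSdef
  have hS : 0 < S := by positivity
  set M := κT * |CE| + D * |CT| + κE * |CT| + κE * κT with hMdef
  set M' := κT * DX + (D + κE) * DT with hM'def
  have hM0 : 0 ≤ M := by positivity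
  have hM'0 : 0 ≤ M' := by positivity
  have h1 := hE N y hy hsep
  have h2 := hT N y hy hsep
  set X := interactionEnergy (effPot w ω A) y - A * N - eUp * N with hX
  set g : ℝ := (goodCount (1 / 20) y : ℝ) with hg
  set l : ℝ := (goodCount η₁ y : ℝ) with hl
  set e : ℝ := (Nat.card {i : Fin N // Ex N y i} : ℝ) with he
  set c : ℝ := (Nat.card {i : Fin N // GoodAt (1 / 20) y i ∨ Ex N y i} : ℝ) with hc
  have hg0 : 0 ≤ g := Nat.cast_nonneg _
  have he0 : 0 ≤ e := Nat.cast_nonneg _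
  have hgl : g ≤ l := by rw [hg, hl]; exact_mod_cast goodCount_mono h01 y
  have hlN : l ≤ N := by rw [hl]; exact_mod_cast goodCount_le η₁ y
  have hgc : g ≤ c := (counts_le (η₀ := 1 / 20) (Ex := Ex) y).1
  have hec : e ≤ c := (counts_le (η₀ := 1 / 20) (Ex := Ex) y).2
  have hCE : CE * g ≤ |CE| * g := mul_le_mul_of_nonneg_right (le_abs_self CE) hg0
  have hCT : CT * g ≤ |CT| * g := mul_le_mul_of_nonneg_right (le_abs_self CT) hg0
  have hDb : DE * ((N : ℝ) - l) ≤ D * ((N : ℝ) - l) := mul_le_mul_of_nonneg_right hDE (by linarith)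
  have hE' : κE * (l - g) ≤ X + |CE| * g + D * ((N : ℝ) - l) + DX * e := by linarith
  have hT' : κT * ((N : ℝ) - l) ≤ X + |CT| * g + DT * e := by linarith
  have e1 := mul_le_mul_of_nonneg_left hE' hκT.le
  have e2 := mul_le_mul_of_nonneg_left hT' hD0
  have e3 := mul_le_mul_of_nonneg_left hT' hκE.le
  have d1 := sub_nonneg.2 e1
  have d2 := sub_nonneg.2 e2
  have d3 := sub_nonneg.2 e3
  have key : S * X - (κE * κT * N - M * g - M' * e) =
      (κT * (X + |CE| * g + D * ((N : ℝ) - l) + DX * e) - κT * (κE * (l - g))) +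
        (D * (X + |CT| * g + DT * e) - D * (κT * ((N : ℝ) - l))) +
        (κE * (X + |CT| * g + DT * e) - κE * (κT * ((N : ℝ) - l))) := by
    rw [hMdef, hM'def, hSdef]; ring
  have hmain : κE * κT * N - M * g - M' * e ≤ S * X := by linarith [d1, d2, d3, key]
  have hmain' : κE * κT * N - (M + M') * c ≤ S * X := by
    nlinarith [mul_le_mul_of_nonneg_left hgc hM0, mul_le_mul_of_nonneg_left hec hM'0]
  have hdiv : κE * κT / S * N - (M + M') / S * c ≤ X := by
    calc κE * κT / S * N - (M + M') / S * c = (κE * κT * N - (M + M') * c) / S := by field_simp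
      _ ≤ S * X / S := div_le_div_of_nonneg_right hmain' hS.le
      _ = X := by field_simp
  have : (eUp + κE * κT / S) * N - (M + M') / S * c = eUp * N + (κE * κT / S * N - (M + M') / S * c) := by ring
  rw [this, hX] at *
  linarith

/-- **`SF ∧ UP(eUp) ∧ Topt♭ ∧ Eopt♭ ⟹ ExemptFDG Ex`** (lens-5's `fdgOpt_of_split`; both rates `κ_T, κ_E > 0`, allowances `D_T, D_X ≥ 0`). [folklore] -/
theorem exemptFDG_of_splitX {η₁ : ℝ} {w ω : ℝ → ℝ} {A eUp κT CT DT κE CE DE DX : ℝ} {Ex : SitePred}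
    (h01 : (1 : ℝ) / 20 ≤ η₁) (hF : SchurFloor w ω A) (hU : PeriodicEnergyCeiling eUp)
    (hκT : 0 < κT) (hDT : 0 ≤ DT) (hT : SchurTopologicalPricingX (1 / 20) η₁ w ω A eUp κT CT DT Ex)
    (hκE : 0 < κE) (hDX : 0 ≤ DX) (hE : SchurElasticPricingX (1 / 20) η₁ w ω A eUp κE CE DE DX Ex) : ExemptFDG Ex := by
  refine exemptFDG_of_schurCutX hF hU (schurRangeGapX_of_splitX h01 hκT hDT hT hκE hDX hE) ?_
  have hS : 0 < κT + max DE 0 + κE := by positivity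
  have : 0 < κE * κT / (κT + max DE 0 + κE) := div_pos (mul_pos hκE hκT) hS
  linarith

/-! ## §3. The crux BY NAME from the split with exemptions -/

/-- **Generic node**: `MuEquilibriumDoor ∧ SF(w, ω, A) ∧ UP(eUp) ∧ DeepAbsent M Ex ∧ Topt♭ ∧ Eopt♭ ⟹ AperiodicFrustratedLawGap`. [folklore] -/
theorem aperiodicFrustratedLawGap_of_splitX {η₁ : ℝ} {w ω : ℝ → ℝ} {A eUp κT CT DT κE CE DE DX M : ℝ} {Ex : SitePred}
    (hDoor : Summit.AtomisticToContinuum.Crystallization.Theses.GrainCoreNetworkSplit.MuEquilibriumDoor)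
    (h01 : (1 : ℝ) / 20 ≤ η₁) (hF : SchurFloor w ω A) (hU : PeriodicEnergyCeiling eUp) (hEx : DeepAbsent M Ex)
    (hκT : 0 < κT) (hDT : 0 ≤ DT) (hT : SchurTopologicalPricingX (1 / 20) η₁ w ω A eUp κT CT DT Ex)
    (hκE : 0 < κE) (hDX : 0 ≤ DX) (hE : SchurElasticPricingX (1 / 20) η₁ w ω A eUp κE CE DE DX Ex) :
    Summit.AtomisticToContinuum.Crystallization.Theses.FrustratedLawDichotomy.AperiodicFrustratedLawGap :=
  aperiodicFrustratedLawGap_of_exemptFDG hDoor hEx (exemptFDG_of_splitX h01 hF hU hκT hDT hT hκE hDX hE)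

/-- **Generic node, sibling** (`PeriodicFrustratedLawGap`, item 27624). [folklore] -/
theorem periodicFrustratedLawGap_of_splitX {η₁ : ℝ} {w ω : ℝ → ℝ} {A eUp κT CT DT κE CE DE DX M : ℝ} {Ex : SitePred}
    (hDoor : Summit.AtomisticToContinuum.Crystallization.Theses.GrainCoreNetworkSplit.MuEquilibriumDoor)
    (h01 : (1 : ℝ) / 20 ≤ η₁) (hF : SchurFloor w ω A) (hU : PeriodicEnergyCeiling eUp) (hEx : DeepAbsent M Ex)
    (hκT : 0 < κT) (hDT : 0 ≤ DT) (hT : SchurTopologicalPricingX (1 / 20) η₁ w ω A eUp κT CT DT Ex)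
    (hκE : 0 < κE) (hDX : 0 ≤ DX) (hE : SchurElasticPricingX (1 / 20) η₁ w ω A eUp κE CE DE DX Ex) :
    Summit.AtomisticToContinuum.Crystallization.Theses.FrustratedLawDichotomy.PeriodicFrustratedLawGap :=
  periodicFrustratedLawGap_of_exemptFDG hDoor hEx (exemptFDG_of_splitX h01 hF hU hκT hDT hT hκE hDX hE)

/-- **Node of record (range `9/2`, `η₁ = 1/8`), any deep-absent exemption**: `MuEquilibriumDoor ∧ SF₄₅ ∧ UP(−0.7175) ∧ DeepAbsent M Ex ∧
Topt♭₄₅(κ_T, C_T, D_T; Ex) ∧ Eopt♭₄₅(κ_E, C_E, D_E, D_X; Ex) ⟹` crux. [folklore] -/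
theorem aperiodicFrustratedLawGap_of_splitX_fourHalf {κT CT DT κE CE DE DX M : ℝ} {Ex : SitePred}
    (hDoor : Summit.AtomisticToContinuum.Crystallization.Theses.GrainCoreNetworkSplit.MuEquilibriumDoor)
    (hF : SF₄₅) (hU : PeriodicEnergyCeiling (-(7175 / 10000))) (hEx : DeepAbsent M Ex)
    (hκT : 0 < κT) (hDT : 0 ≤ DT) (hT : SchurTopologicalPricingX (1 / 20) (1 / 8) w₄₅ ω₄ (3 / 400) (-(7175 / 10000)) κT CT DT Ex)
    (hκE : 0 < κE) (hDX : 0 ≤ DX) (hE : SchurElasticPricingX (1 / 20) (1 / 8) w₄₅ ω₄ (3 / 400) (-(7175 / 10000)) κE CE DE DX Ex) :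
    Summit.AtomisticToContinuum.Crystallization.Theses.FrustratedLawDichotomy.AperiodicFrustratedLawGap :=
  aperiodicFrustratedLawGap_of_splitX hDoor (by norm_num) hF hU hEx hκT hDT hT hκE hDX hE

/-- ★ **Node of record with the LOCAL-OPTIMALITY exemption** (lens-5 g38 «OptimalityCut» assembly): `MuEquilibriumDoor ∧ SF₄₅ ∧ UP(−0.7175) ∧
Topt♭₄₅(κ_T, C_T, D_T; ¬LocOpt e⋆ ε ϱ K) ∧ Eopt♭₄₅(κ_E, C_E, D_E, D_X; ¬LocOpt e⋆ ε ϱ K) ⟹` crux, for every `ε > 0`, `ϱ`, `K`. [folklore] -/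
theorem aperiodicFrustratedLawGap_of_split_locOpt_fourHalf {κT CT DT κE CE DE DX ε ϱ : ℝ} {K : ℕ}
    (hDoor : Summit.AtomisticToContinuum.Crystallization.Theses.GrainCoreNetworkSplit.MuEquilibriumDoor)
    (hF : SF₄₅) (hU : PeriodicEnergyCeiling (-(7175 / 10000))) (hε : 0 < ε)
    (hκT : 0 < κT) (hDT : 0 ≤ DT)
    (hT : SchurTopologicalPricingX (1 / 20) (1 / 8) w₄₅ ω₄ (3 / 400) (-(7175 / 10000)) κT CT DT (LocOptFails eStar ε ϱ K))
    (hκE : 0 < κE) (hDX : 0 ≤ DX)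
    (hE : SchurElasticPricingX (1 / 20) (1 / 8) w₄₅ ω₄ (3 / 400) (-(7175 / 10000)) κE CE DE DX (LocOptFails eStar ε ϱ K)) :
    Summit.AtomisticToContinuum.Crystallization.Theses.FrustratedLawDichotomy.AperiodicFrustratedLawGap :=
  aperiodicFrustratedLawGap_of_splitX_fourHalf hDoor hF hU (deepAbsent_locOptFails hε) hκT hDT hT hκE hDX hE

/-- **Node of record with the `e⋆`-free EXCHANGE exemption.** [folklore] -/
theorem aperiodicFrustratedLawGap_of_split_exchange_fourHalf {κT CT DT κE CE DE DX ε ϱ : ℝ} {K : ℕ}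
    (hDoor : Summit.AtomisticToContinuum.Crystallization.Theses.GrainCoreNetworkSplit.MuEquilibriumDoor)
    (hF : SF₄₅) (hU : PeriodicEnergyCeiling (-(7175 / 10000))) (hε : 0 < ε)
    (hκT : 0 < κT) (hDT : 0 ≤ DT)
    (hT : SchurTopologicalPricingX (1 / 20) (1 / 8) w₄₅ ω₄ (3 / 400) (-(7175 / 10000)) κT CT DT (ExchangeUnstable ε ϱ K))
    (hκE : 0 < κE) (hDX : 0 ≤ DX)
    (hE : SchurElasticPricingX (1 / 20) (1 / 8) w₄₅ ω₄ (3 / 400) (-(7175 / 10000)) κE CE DE DX (ExchangeUnstable ε ϱ K)) :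
    Summit.AtomisticToContinuum.Crystallization.Theses.FrustratedLawDichotomy.AperiodicFrustratedLawGap :=
  aperiodicFrustratedLawGap_of_splitX_fourHalf hDoor hF hU (deepAbsent_exchangeUnstable hε) hκT hDT hT hκE hDX hE

/-- **Node of record with the REMOVAL exemption** (`Ex = RemovalUnstable (−0.7175) t`, `t > 0`). [folklore] -/
theorem aperiodicFrustratedLawGap_of_split_removal_fourHalf {κT CT DT κE CE DE DX t : ℝ}
    (hDoor : Summit.AtomisticToContinuum.Crystallization.Theses.GrainCoreNetworkSplit.MuEquilibriumDoor)
    (hF : SF₄₅) (hU : PeriodicEnergyCeiling (-(7175 / 10000))) (ht : 0 < t)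
    (hκT : 0 < κT) (hDT : 0 ≤ DT)
    (hT : SchurTopologicalPricingX (1 / 20) (1 / 8) w₄₅ ω₄ (3 / 400) (-(7175 / 10000)) κT CT DT (RemovalUnstable (-(7175 / 10000)) t))
    (hκE : 0 < κE) (hDX : 0 ≤ DX)
    (hE : SchurElasticPricingX (1 / 20) (1 / 8) w₄₅ ω₄ (3 / 400) (-(7175 / 10000)) κE CE DE DX (RemovalUnstable (-(7175 / 10000)) t)) :
    Summit.AtomisticToContinuum.Crystallization.Theses.FrustratedLawDichotomy.AperiodicFrustratedLawGap :=
  aperiodicFrustratedLawGap_of_splitX_fourHalf hDoor hF hU (deepAbsent_removalUnstable_of_up hU ht) hκT hDT hT hκE hDX hE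

end Summit.AtomisticToContinuum.Crystallization.Theorems.FrustratedLawDichotomyExemptSplit

end
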